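import Summits.QuantumAdvantage.QuantumAdvantage.Theorems.CubicForrelationSignedExactCubicForrelationNotPrBPPGrowMachineClosedKset
import Summits.QuantumAdvantage.QuantumAdvantage.Theorems.CubicForrelationSignedExactCubicForrelationNotPrBPPGrowMachine

/-!
# Crux `CubicForrelation.SignedExactCubicForrelationNotPrBPP` (stmt-QuantumAdvantage-13932), line `dual-pingpong-frame`
# (GROW reshape): the GROW machine, IX — a terminal state passes the certificate

Proof-only support file (`--supports stmt-QuantumAdvantage-13932`) toward the registered stub `stub_growFinder`; sequel
of `…GrowMachineClosedKset.lean`. **Terminal states of the invariant are certified** (`certOK_rowsOut`): for an exact cubic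
pair `(f, g)` (`Φ(g, f) = ±1`) and a state `(S, U)` satisfying the invariant (bases of length `≤ m`, closed both ways,
orthogonal, `n = 2m`),

* if `|S| = m`: the rows `0ⁿ :: S` have rank `m = n / 2`, and `span S`, being closed and orthogonal to `span U`, is FLAT
  for `g` (`NoTrap.flat_of_closed_orth`), so every second difference of `g` along two output rows vanishes — in
  particular at `0ⁿ` and the unit vectors, which is the test of `MMReadout.certOK`;
* if `|U| = m`: `span U` is flat for `f` of size `2^m`, i.e. an M-subspace of `f`; by the landed frame lock
  (`stub_frameLock`, applied to the pair `(g, f)`) its orthogonal `(span U)^⊥` — the span of the kernel basis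
  `kerOf n U`, of size `2ⁿ / 2^m = 2^m` (`perp_perp_eq_of_sq`) — is an M-subspace of `g`, and the rows
  `0ⁿ :: kerOf n U` pass the certificate likewise.

## References

* C. Carlet, *Boolean Functions for Cryptography and Coding Theory*, CUP 2021, Prop. 54, Prop. 77. [Carlet2020]
* D. E. Knuth, *TAOCP* Vol. 2, 3rd ed., §4.6.2 Algorithm N. [KnuthTAOCP2]
-/

noncomputable section

set_option linter.dupNamespace false -- D-0017: single-problem summit ⇒ `QuantumAdvantage.QuantumAdvantage` by design

namespace Summit.QuantumAdvantage.QuantumAdvantage.Theorems.SignedExactCubicForrelationNotPrBPP.GrowMachine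

open Finset
open Literature.Computability.Complexity Literature.Computability.QuantumComplexity
open Literature.Computability.Complexity.F2Elim
open Literature.Computability.Complexity.BLR (toZ toZ_xor toZ_and toZ_injective)
open Literature.Computability.QuantumComplexity.BuzetChailloux (bxor zeroVec bxor_self bxor_comm bxor_zeroVec zeroVec_bxor)
open PolarGeometry (toZ_bdot bdot_comm bdot_bxor_left bdot_bxor_right twist_eq_one_iff_bdot)
open NoTrap (bdot_zeroVec bdot_unit D_symm D_bxor_left D_zeroVec_eq flat_of_closed_orth)
open ForrCode QuadSampler MMReadout
open FinderMachine (Vec Mat normV basisOf kerOf inSpan)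

variable {n m : ℕ}

/-! ### Reading the invariant's closedness in the form of the flatness lemma -/

/-- The offset clause in `D`-form gives the offset clause of `NoTrap.flat_of_closed_orth`. [cite: Carlet2020, §2.2.2] -/
theorem offs_fform {f : (Fin n → Bool) → Bool} (D : (Fin n → Bool) → (Fin n → Bool) → (Fin n → Bool) → Bool)
    (hD : ∀ u v x, D u v x = (f x ^^ f (bxor x u) ^^ f (bxor x v) ^^ f (bxor x (bxor u v)))) {A B : Finset (Fin n → Bool)}
    (h : ∀ s ∈ A, ∃ ℓ ∈ B, ∀ r : Fin n → Bool, (∀ y z : Fin n → Bool, (D s r z ^^ D s r (bxor z y)) = false) →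
        D s r zeroVec = (univ.filter fun i => ℓ i && r i).card.bodd) :
    ∀ s ∈ A, ∃ ℓ ∈ B, ∀ r : Fin n → Bool, (∀ y z : Fin n → Bool, (D s r z ^^ D s r (bxor z y)) = false) →
        (f r ^^ f (bxor r s) ^^ f zeroVec ^^ f s) = (univ.filter fun i => ℓ i && r i).card.bodd := by
  intro s hs
  obtain ⟨ℓ, hℓ, h'⟩ := h s hs
  exact ⟨ℓ, hℓ, fun r hr => by rw [← D_zeroVec_eq D hD]; exact h' r hr⟩

/-- The rank of `0ⁿ :: R` is the rank of `R`. [folklore] -/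
theorem rowSpan_zeroL_cons (R : Mat) : rowSpan n (zeroL n :: R) = rowSpan n R := by
  rw [show zeroL n :: R = [zeroL n] ++ R from rfl, rowSpan_append]
  refine sup_eq_right.2 (Submodule.span_le.2 ?_)
  rintro v ⟨r, hr, rfl⟩
  rw [List.mem_singleton.1 hr, vecZ_eq_bz, toInput_zeroL, show (zeroV : Fin n → Bool) = zeroV from rfl, bz_zeroV]
  exact Submodule.zero_mem _

/-- The rank of a basis is its length. [cite: KnuthTAOCP2, §4.6.2 Algorithm N] -/
theorem finrank_eq_length_of_basis {S : Mat} (hS : (spanV n S).card = 2 ^ S.length) : Module.finrank (ZMod 2) (rowSpan n S) = S.length := by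
  rw [card_spanV] at hS
  exact Nat.pow_right_injective le_rfl hS

/-- The `certOK` test on a list of rows whose span is flat for `g` and of rank `m = n / 2`. [cite: Carlet2020, Prop. 54] -/
theorem certOK_of_flat {g : (Fin n → Bool) → Bool} (D : (Fin n → Bool) → (Fin n → Bool) → (Fin n → Bool) → Bool)
    (hD : ∀ u v x, D u v x = (g x ^^ g (bxor x u) ^^ g (bxor x v) ^^ g (bxor x (bxor u v))))
    {cg : PCirc} (hg : ∀ v, evalP cg v = g (toInput n v)) (hn : n = m + m) (L : Mat)
    (hrank : Module.finrank (ZMod 2) (rowSpan n L) = m) (hflat : ∀ u ∈ spanV n L, ∀ v ∈ spanV n L, ∀ x, D u v x = false) :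
    certOK n cg L = true := by
  simp only [certOK, Bool.and_eq_true, decide_eq_true_eq, List.all_eq_true, Bool.not_eq_true']
  refine ⟨by rw [npiv_eq_finrank, hrank, hn]; ring, fun rs hrs y _ => ?_⟩
  obtain ⟨hr, hs⟩ := List.pair_mem_product.1 (show (rs.1, rs.2) ∈ L.product L from hrs)
  rw [d2_eq_D D hD hg]
  exact hflat _ (toInput_mem_spanV hr) _ (toInput_mem_spanV hs) _

section Terminal

variable {f g : (Fin n → Bool) → Bool} (Df Dg : (Fin n → Bool) → (Fin n → Bool) → (Fin n → Bool) → Bool)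
  (hDf : ∀ u v x, Df u v x = (f x ^^ f (bxor x u) ^^ f (bxor x v) ^^ f (bxor x (bxor u v))))
  (hDg : ∀ u v x, Dg u v x = (g x ^^ g (bxor x u) ^^ g (bxor x v) ^^ g (bxor x (bxor u v))))
  {cf cg : PCirc} (hf : ∀ v, evalP cf v = f (toInput n v)) (hg : ∀ v, evalP cg v = g (toInput n v))
  (hf3 : IsDegLeFun 3 f) (hg3 : IsDegLeFun 3 g)
  (Clf Clg : Finset (Fin n → Bool) → Finset (Fin n → Bool) → Prop)
  (hClf : ∀ A B, Clf A B ↔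
    ((∀ s ∈ A, ∀ y : Fin n → Bool, (fun k => (Df s y zeroVec ^^ Df s y (fun j => decide (j = k)))) ∈ B) ∧
     (∀ s ∈ A, ∃ ℓ ∈ B, ∀ r : Fin n → Bool, (∀ y z : Fin n → Bool, (Df s r z ^^ Df s r (bxor z y)) = false) →
        Df s r zeroVec = (univ.filter fun i => ℓ i && r i).card.bodd)))
  (hClg : ∀ A B, Clg A B ↔
    ((∀ s ∈ A, ∀ y : Fin n → Bool, (fun k => (Dg s y zeroVec ^^ Dg s y (fun j => decide (j = k)))) ∈ B) ∧
     (∀ s ∈ A, ∃ ℓ ∈ B, ∀ r : Fin n → Bool, (∀ y z : Fin n → Bool, (Dg s r z ^^ Dg s r (bxor z y)) = false) →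
        Dg s r zeroVec = (univ.filter fun i => ℓ i && r i).card.bodd)))
  (Inv : Mat × Mat → Prop)
  (hInv : ∀ p, Inv p ↔
    ((spanV n p.1).card = 2 ^ p.1.length ∧ (spanV n p.2).card = 2 ^ p.2.length) ∧ (p.1.length ≤ m ∧ p.2.length ≤ m) ∧
      Clg (spanV n p.1) (spanV n p.2) ∧ Clf (spanV n p.2) (spanV n p.1) ∧
      ∀ s ∈ spanV n p.1, ∀ u ∈ spanV n p.2, (univ.filter fun i => s i && u i).card.bodd = false)

include hDf hDg hg hf3 hg3 hClf hClg hInv in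
omit hf in
/-- **A terminal state of the invariant passes the certificate.** [cite: Carlet2020, Prop. 54] -/
theorem certOK_rowsOut (hn : n = m + m) (hΦ : forrelation g f = 1 ∨ forrelation g f = -1) {p : Mat × Mat} (hp : Inv p)
    (ht : terminal m p = true) : certOK n cg (rowsOut n m p) = true := by
  obtain ⟨⟨hb1, hb2⟩, -, hcg, hcf, horth⟩ := (hInv p).1 hp
  -- flatness of both spans (closed + orthogonal ⇒ flat)
  obtain ⟨growS, goffS⟩ := (hClg _ _).1 hcg
  obtain ⟨frowU, foffU⟩ := (hClf _ _).1 hcf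
  have hflatS : ∀ u ∈ spanV n p.1, ∀ v ∈ spanV n p.1, ∀ x, Dg u v x = false :=
    flat_of_closed_orth hg3 Dg hDg growS (offs_fform Dg hDg goffS) horth
  have hflatU : ∀ u ∈ spanV n p.2, ∀ v ∈ spanV n p.2, ∀ x, Df u v x = false :=
    flat_of_closed_orth hf3 Df hDf frowU (offs_fform Df hDf foffU) fun s hs u hu => by rw [bdot_comm]; exact horth u hu s hs
  unfold rowsOut
  by_cases hS : p.1.length = m
  · -- `|S| = m`
    rw [if_pos (decide_eq_true hS)]
    refine certOK_of_flat Dg hDg hg hn _ ?_ ?_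
    · rw [rowSpan_zeroL_cons, finrank_eq_length_of_basis hb1, hS]
    · have hsp : spanV n (zeroL n :: p.1) = spanV n p.1 := by ext v; rw [mem_spanV, mem_spanV, rowSpan_zeroL_cons]
      rw [hsp]; exact hflatS
  · -- `|U| = m`: the kernel basis of `U` spans `(span U)^⊥`, an M-subspace of `g` by the frame lock
    rw [if_neg (by simpa using hS)]
    have hU : p.2.length = m := by
      simp only [terminal, Bool.or_eq_true, decide_eq_true_eq] at ht
      exact ht.resolve_left hS
    have hsp : spanV n (zeroL n :: kerOf n p.2) = spanV n (kerOf n p.2) := by ext v; rw [mem_spanV, mem_spanV, rowSpan_zeroL_cons]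
    -- `span U` is an M-subspace of `f`
    have hUc : ((spanV n p.2).card : ℝ) ^ 2 = (2 : ℝ) ^ n := by
      rw [hb2, hU, hn]; push_cast; rw [← pow_mul]; ring_nf
    have hMU : (zeroVec ∈ spanV n p.2 ∧ ∀ x ∈ spanV n p.2, ∀ y ∈ spanV n p.2, bxor x y ∈ spanV n p.2) ∧
        (((spanV n p.2).card : ℝ) ^ 2 = (2 : ℝ) ^ n) ∧
        ∀ u ∈ spanV n p.2, ∀ v ∈ spanV n p.2, ∀ x, (f x ^^ f (bxor x u) ^^ f (bxor x v) ^^ f (bxor x (bxor u v))) = false :=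
      ⟨⟨zeroVec_mem_spanV _, fun _ hx _ hy => bxor_mem_spanV hx hy⟩, hUc, fun u hu v hv x => by rw [← hDf]; exact hflatU u hu v hv x⟩
    obtain ⟨⟨-, -, hflatP⟩, -, -⟩ := stub_frameLock n g f (spanV n p.2) hΦ hMU
    -- the perp of `span U` is the span of the kernel basis
    have hperp : ∀ v, v ∈ spanV n (kerOf n p.2) ↔ v ∈ (univ.filter fun y => ∀ x ∈ spanV n p.2, twist x y = 1) := by
      intro v
      rw [mem_spanV_kerOf_iff, bz_mem_kerSet_rows_iff, mem_filter]
      exact ⟨fun h => ⟨mem_univ _, fun x hx => (twist_eq_one_iff_bdot x v).2 (h x hx)⟩, fun h x hx => (twist_eq_one_iff_bdot x v).1 (h.2 x hx)⟩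
    have hpeq : spanV n (kerOf n p.2) = (univ.filter fun y => ∀ x ∈ spanV n p.2, twist x y = 1) := Finset.ext hperp
    refine certOK_of_flat Dg hDg hg hn _ ?_ ?_
    · rw [rowSpan_zeroL_cons]
      have hc := (DerivativeWalsh.perp_perp_eq_of_sq (zeroVec_mem_spanV p.2) (fun _ hx _ hy => bxor_mem_spanV hx hy) hUc).2
      rw [← hpeq, card_spanV, hb2, hU] at hc
      exact_mod_cast Nat.pow_right_injective le_rfl (by exact_mod_cast hc : (2 : ℕ) ^ Module.finrank (ZMod 2) (rowSpan n (kerOf n p.2)) = 2 ^ m)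
    · rw [hsp]
      intro u hu v hv x
      rw [hDg]
      exact hflatP u ((hperp u).1 hu) v ((hperp v).1 hv) x

end Terminal

/-- **The zero row does not change the row span** (registered brick `grow_rowSpanZeroCons` of stub `stub_growFinder`, line `dual-pingpong-frame`, crux stmt-QuantumAdvantage-13932). [folklore] -/
theorem grow_rowSpanZeroCons : ∀ {n : ℕ} (R : List (List Bool)), F2Elim.rowSpan n (QuadSampler.zeroL n :: R) = F2Elim.rowSpan n R :=
  fun R => rowSpan_zeroL_cons R

end Summit.QuantumAdvantage.QuantumAdvantage.Theorems.SignedExactCubicForrelationNotPrBPP.GrowMachine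

end
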